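import Literature.NumberTheory.DiophantineGeometry.GenEllAnnulus
import Literature.NumberTheory.DiophantineGeometry.GenEllPullbackConductor
import HarnessLib

/-!
# [GenEll] Ex. 1.3 (ii) / Thm. 2.1 (ii) / Prop. 1.7: the predicates `CBData.Mem`,
# `CBData.SupportContains`, `NFPoint.MapsUnder` are VOCABULARY (FACT-LIST rows F-2763, F-2764, F-2765)

S. Mochizuki, *Arithmetic elliptic curves in general position*, Math. J. Okayama Univ. **52** (2010)
[cite: MochizukiGenEll2010] (kurims manuscript): Example 1.3 (ii) pp. 5–6 ("compactly bounded subset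
`K_V ⊆ U(Q̄)`" — membership: "the set of `[F:ℚ]` points … determined by `x` is contained in `K_v`"),
Theorem 2.1 (ii) p. 11 ("a compactly bounded subset whose support contains `Σ`"), Proposition 1.7 p. 9
(`y ↦ x` under a finite map `φ`).  Proof-only companion (no `def`, no `instance`) to
`GenEllProjLine.lean` / `GenEllPullbackConductor.lean` (abc-iut layer S), abc-iut block F (fact-proving
wave, floating seat abc-iut-f-105, tranche 181), plan header rule R1 (ii).

The three declarations are DEFINITIONS (predicates), not claims of the paper; the FACT-LIST scanner
listed them because their docstrings cite an item.  Recorded here, sorry-free: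

* `CBData.not_mem_ratPoint_zero` / `not_mem_ratPoint_one` — NO compactly bounded subset of
  `U = ℙ¹ ∖ {0,1,∞}` contains the cusps `λ = 0`, `λ = 1` (its archimedean domain lies in `ℂ ∖ {0,1}`);
  `CBData.mem_ratPoint_iff` — for a `ℚ`-rational point `λ = q`, membership in `K_V` is exactly
  "`q ∈ K_∞` and `q ∈ K_p` for `p ∈ V`" (the unique embeddings `ℚ → ℂ`, `ℚ → Q̄_p`);
  `CBData.not_forall_mem` — the universal closure of `Mem` (F-2763) is FALSE (witness: the tree's
  annulus subset `CBData.annulus`, abc-iut `GenEllAnnulus`, and the cusp `0`); consistent instances: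
  `NFPoint.farFromCusps_mem_toSet` (in tree).
* `CBData.supportContains_empty`, `CBData.not_forall_supportContains` — `SupportContains D Σ := Σ ⊆ V`
  (F-2764) holds for `Σ = ∅` and fails for the annulus with support `{∞}` and `Σ = {2}`; instance of
  record `CBData.annulus_supportContains` (in tree).
* `NFPoint.mapsUnder_X` — every point maps to itself under the identity map `φ = (t : 1)`;
  `NFPoint.not_mapsUnder_of_den_eq_zero`, `NFPoint.not_forall_mapsUnder` — for a presentation with
  `g = 0` nothing maps (the universal closure of the structure predicate `MapsUnder`, F-2765, is
  FALSE); instance of record `NFPoint.mapsUnder_imageAt` (in tree, `GenEllCuspTransfer`).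

HONEST FRAMING: bookkeeping about the tree's own vocabulary for [GenEll] §1–§2; nothing here bears on
[GenEll] Thm. 2.1 itself (a named fact, `GenEll_thm21_primes`) or on the disputed [IUTchIII] Cor. 3.12.
-/

noncomputable section

namespace Literature.NumberTheory.DiophantineGeometry.GenEll

open Polynomial

/-! ### F-2763 `CBData.Mem` -/

namespace CBData

/-- No compactly bounded subset of `U_P` contains the cusp `λ = 0` (its members lie in `U`,
`CBData.inU_of_mem`). [cite: MochizukiGenEll2010, Ex 1.3 (ii) p.6] -/
theorem not_mem_ratPoint_zero (D : CBData) : ¬ D.Mem (ratPoint 0) :=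
  fun h => (inU_of_mem h).1 rfl

/-- No compactly bounded subset of `U_P` contains the cusp `λ = 1`. [cite: MochizukiGenEll2010, Ex 1.3 (ii) p.6] -/
theorem not_mem_ratPoint_one (D : CBData) : ¬ D.Mem (ratPoint 1) :=
  fun h => (inU_of_mem h).2 rfl

/-- **Membership of a `ℚ`-rational point** `λ = q` in `K_V`: since `ℚ` has exactly one embedding into
`ℂ` and into each `Q̄_p`, "the set of points determined by `x` is contained in `K_v`" reads
`q ∈ K_∞` and `q ∈ K_p` for every `p` in the support. [cite: MochizukiGenEll2010, Ex 1.3 (ii) p.6] -/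
theorem mem_ratPoint_iff (D : CBData) (q : ℚ) :
    D.Mem (ratPoint q) ↔
      ((q : ℂ) ∈ D.Karc ∧ ∀ p ∈ D.primes, ∀ [Fact p.Prime], ((q : PadicAlgCl p)) ∈ D.Knon p) := by
  constructor
  · rintro ⟨harc, hnon⟩
    refine ⟨?_, fun p hp _ => ?_⟩
    · -- the unique embedding `ℚ → ℂ` is `Rat.cast`; `(Rat.castHom ℂ) q` unfolds to `↑q`
      exact harc (Rat.castHom ℂ)
    · exact hnon p hp (Rat.castHom (PadicAlgCl p))
  · rintro ⟨harc, hnon⟩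
    refine ⟨fun σ => ?_, fun p hp _ σ => ?_⟩
    · have hσ : σ (ratPoint q).x = (q : ℂ) := eq_ratCast σ q
      rw [hσ]
      exact harc
    · have hσ : σ (ratPoint q).x = (q : PadicAlgCl p) := eq_ratCast σ q
      rw [hσ]
      exact hnon p hp

/-- **F-2763, universal closure REFUTED**: not every point lies in every compactly bounded subset —
the cusp `0` lies in none, and compactly bounded subsets exist (the annulus subset with support
`{∞}` and `ρ = 1/2`, `CBData.annulus`).  `Mem` is the membership PREDICATE of Ex. 1.3 (ii); nothing
to assume. [cite: MochizukiGenEll2010, Ex 1.3 (ii) p.6] -/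
theorem not_forall_mem :
    ¬ ∀ (D : CBData) (P : NFPoint),
        Literature.NumberTheory.DiophantineGeometry.GenEll.CBData.Mem D P :=
  fun h => not_mem_ratPoint_zero
    (annulus ∅ (fun _ hp => absurd hp (Finset.notMem_empty _)) (1 / 2) (by norm_num) le_rfl)
    (h _ _)

/-- Both truth values occur: some point lies in some `K_V` and some point does not (closed form).
[cite: MochizukiGenEll2010, Ex 1.3 (ii) p.6] -/
theorem exists_mem_and_exists_not_mem :
    (∃ (D : CBData) (P : NFPoint), D.Mem P) ∧ ∃ (D : CBData) (P : NFPoint), ¬ D.Mem P := by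
  let D : CBData :=
    annulus ∅ (fun _ hp => absurd hp (Finset.notMem_empty _)) (1 / 2) (by norm_num) le_rfl
  refine ⟨⟨D, ratPoint (-1), ?_⟩, ⟨D, ratPoint 0, not_mem_ratPoint_zero D⟩⟩
  rw [mem_ratPoint_iff]
  refine ⟨?_, fun p hp => absurd hp (Finset.notMem_empty _)⟩
  show ((-1 : ℚ) : ℂ) ∈ annArc (1 / 2)
  have e : ((-1 : ℚ) : ℂ) = -1 := by push_cast; rfl
  have n1 : ‖(-1 : ℂ)‖ = 1 := by rw [norm_neg, norm_one]
  have n2 : ‖(-1 : ℂ) - 1‖ = 2 := by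
    rw [show (-1 : ℂ) - 1 = -2 by norm_num, norm_neg]
    simp
  rw [e]
  apply mem_annArc_of_lt
  · rw [n1]; norm_num
  · rw [n1]; norm_num
  · rw [n2]; norm_num

/-! ### F-2764 `CBData.SupportContains` -/

/-- Every support contains the empty set of primes. [cite: MochizukiGenEll2010, Thm 2.1 (ii) p.11] -/
theorem supportContains_empty (D : CBData) : D.SupportContains ∅ :=
  Finset.empty_subset _

/-- The support always contains itself (the instance used with `CBData.annulus S`, cf.
`annulus_supportContains`). [cite: MochizukiGenEll2010, Thm 2.1 (ii) p.11] -/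
theorem supportContains_primes (D : CBData) : D.SupportContains D.primes :=
  subset_rfl

/-- **F-2764, universal closure REFUTED**: the annulus subset with nonarchimedean support `∅` does not
have support containing `{2}`.  `SupportContains D Σ := Σ ⊆ V^non` is the PREDICATE "whose support
contains `Σ`" of Thm. 2.1 (ii); nothing to assume. [cite: MochizukiGenEll2010, Thm 2.1 (ii) p.11] -/
theorem not_forall_supportContains :
    ¬ ∀ (D : CBData) (S : Finset ℕ),
        Literature.NumberTheory.DiophantineGeometry.GenEll.CBData.SupportContains D S := by
  intro h
  have h2 := h (annulus ∅ (fun _ hp => absurd hp (Finset.notMem_empty _)) (1 / 2) (by norm_num)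
    le_rfl) {2}
  exact absurd (h2 (Finset.mem_singleton_self 2)) (Finset.notMem_empty 2)

end CBData

/-! ### F-2765 `NFPoint.MapsUnder` -/

namespace NFPoint

/-- Under the identity map `φ = (t : 1)` (`f = t`, `g = 1`, `n = 1`) every point maps to itself over
the identity of its field: `g(x) = 1 ≠ 0`, `f(x) = x = x · g(x)`. [cite: MochizukiGenEll2010, Prop 1.7 p.9] -/
theorem mapsUnder_X (P : NFPoint) :
    MapsUnder ⟨X, 1, 1, natDegree_X_le, by simp⟩ P P (RingHom.id P.F) where
  den_ne_zero := by simp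
  num_eq := by simp

/-- For a presentation with `g = 0` (allowed by `P1FiniteMap`, which records only `deg f, deg g ≤ n`)
no point maps under `φ`: the clause `g(y) ≠ 0` fails. [cite: MochizukiGenEll2010, Prop 1.7 p.9] -/
theorem not_mapsUnder_of_den_eq_zero {φ : P1FiniteMap} (hφ : φ.den = 0) (P Q : NFPoint)
    (ι : P.F →+* Q.F) : ¬ MapsUnder φ P Q ι :=
  fun h => h.den_ne_zero (by rw [hφ, map_zero])

/-- **F-2765, universal closure REFUTED**: `MapsUnder φ P Q ι` ("`x = φ(y)`", Prop. 1.7) is a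
structure PREDICATE; it fails e.g. for `φ = (t : 0)` and any point over the identity, and holds for
the identity map (`mapsUnder_X`); instance of record for consumers: `NFPoint.mapsUnder_imageAt`.
Nothing to assume. [cite: MochizukiGenEll2010, Prop 1.7 p.9] -/
theorem not_forall_mapsUnder :
    ¬ ∀ (φ : P1FiniteMap) (P Q : NFPoint) (ι : P.F →+* Q.F),
        Literature.NumberTheory.DiophantineGeometry.GenEll.NFPoint.MapsUnder φ P Q ι :=
  fun h => not_mapsUnder_of_den_eq_zero (φ := ⟨X, 0, 1, natDegree_X_le, by simp⟩) rfl
    (ratPoint 2) (ratPoint 2) (RingHom.id ℚ) (h _ _ _ _)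

end NFPoint

end Literature.NumberTheory.DiophantineGeometry.GenEll

end
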